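import Summits.QuantumFields.BalabanUV.Beta.RemainderExplicitHistoryDiagonalExistence

/-!
# RemainderExplicitHistoryDiagonalCauchy — ROAD P3: NODE U6's CAUCHY SUM WITHOUT NE4 AS TYPED AND WITHOUT FADING MEMORY — node U6's
# transported total `T4CauchySum.delta E ρ inj K = E·Σ_{j+n=K} disc(g^{(K)}, g^{(K+1)}, j)·ρ^n` weights the infrared distance `n` by the
# contraction `ρ^n`, so its sum over the cutoff IS the `ρ^m`-weighted sum of the station's DIAGONAL sums: bounded diagonal sums `≤ B_m` with
# `Σ_m ρ^m B_m < ∞` (e.g. the station's `B_m = m·S∕(1 − Wγ∕b)`) make `delta` summable, and node U6's generating functions converge uniformly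
# (`abs_genFun_succ_sub_le` ∕ `cauchySeq_genFun` ∕ `tendstoUniformlyOn_genFun` BY NAME) — sixth file of station S-d4p3-g47-1

Cell `pub-balaban`, β-function sub-cell, BINDER row D4 «RemainderConst leaves for Bałaban's split» (`HOME/BINDER-OWNERS.md`; owner
lineage `b2b-balaban-beta-an4`; this file by co-owner #3 lineage `b2b-balaban-beta-d4-p3`, road P3 «the reduction road», generation 47,
station S-d4p3-g47-1, sixth file; imports the station's `RemainderExplicitHistoryDiagonalExistence` (hence node U6 `T4CauchySum` through
`T4ContinuumCoupling`)), β-FLOW TEAM duty (1); FREEZE (0) honoured (def-free module in road P3's own `RemainderExplicit*` series; no leaf,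
no interface, no Literature file).  SOURCE OF THE SHAPES ONLY: [Balaban1987RG1] (0.20) p. 256, (0.31) and Thm 2 p. 259, §5 p. 298; the
Cauchy-sum TEMPLATE is C. King, Commun. Math. Phys. **102** (1986) Thm 3.4 p. 656 (cited by node U6 for the shape only).  Pure real
analysis (finite re-indexing, one comparison).

HONEST FRAMING (page 1 of everything the β sub-cell writes).  *"Discharging BetaPertH makes Bałaban's UV stability UNCONDITIONAL —
a real constructive-QFT result; it is NOT the continuum limit and NOT the Clay problem."*  THIS FILE DISCHARGES NOTHING OF THE
KIND.  Node U6 (`T4CauchySum`) derives `Summable (delta E ρ inj)` — the input of its Cauchy sum for the generating functions of the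
unit-scale expectations — from node U2's GEOMETRIC output `InjectedRate C c θ inj`; the sibling's (E33d) `summable_delta_of_stretched`
derives it from the stretched shape (still from NE4 as typed).  Here it is derived from the station's rate-free currency: the sum over
the cutoff of `delta` is EXACTLY `E·Σ_m ρ^m·(diagonal sum at infrared distance m)` (finite re-indexing `(K, j, n) ↔ (m = n, k = j)`,
`K = k + m`), so bounded diagonal sums `B_m` with `Σ_m ρ^m B_m < ∞` suffice — in particular the LINEAR bound `B_m = m·S∕(1 − Wγ∕b)` of
`RemainderExplicitHistoryDiagonalSum.sum_disc_diag_le` (summable scale-shift profile + summable memory profile + floor + `Wγ < b`),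
since `Σ_m m·ρ^m < ∞`.  The linear growth in `m`, the price of dropping every geometric shape, is therefore HARMLESS for node U6: the
transport contraction `ρ^m` pays for it.  Every hypothesis on `β` and on the partition functions (`MatchingModConstants`, node U5's
NOT-IN-PRINT shape) is a binder; nothing of Bałaban's (1.22), β_n or expectations is asserted or constructed; row D4 class UNCHANGED
(critical-path width 0; instance 0∕1; D4 DISCHARGE NO DATE); NOT B12 Thm 2, NOT BetaPertH, NOT continuum, NOT Clay.  HONEST DEPENDENCY:
continuum YM on T⁴ ⇐ BetaPertH ∧ nine spine estimates (0/9 proved); BetaPertH ⇐ (D1) ∧ (D4) ∧ CAP+tail; G-an2-4 gates asym, D1 and NE2/3/4.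
ABSOLUTE RULE: nothing is cited as a fact.

WHAT IS PROVED ([folklore]; 0 sorry; 0 `def`).
* §1 **`sum_delta_eq_sum_diag`** (`Σ_{K<L} delta E ρ inj K = E·Σ_{m<L} ρ^m·Σ_{k<L−m} disc (g (k+m)) (g (k+m+1)) k`: node U6's transported totals
  summed over the cutoff ARE the `ρ^m`-weighted diagonal sums — two triangle swaps and the shift `K = k + m`); `sum_delta_le_of_diag_le`
  (`≤ E·Σ_{m<L} ρ^m B_m`); `delta_nonneg`; **`summable_delta_of_diag_le`** (`Σ_{m<L} ρ^m B_m ≤ T` for all `L` ⟹ `Summable (delta E ρ inj)`);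
  `sum_pow_mul_linear_le` (`Σ_{m<L} ρ^m·(m·C) ≤ C·Σ_n (n+1)ρ^n`, node U6's `summable_succ_pow_mul_geometric` BY NAME).
* §2 **`cauchySum_of_diag_le`**: node U6's assembled Cauchy sum (summable transported totals, consecutive generating functions within
  `2·vol·delta K` on `|t| ≤ l₀`, `CauchySeq`, uniform convergence to `genFunLim Z`) from bounded diagonal sums + `MatchingModConstants` — node U6's
  `abs_genFun_succ_sub_le` ∕ `cauchySeq_genFun` ∕ `tendstoUniformlyOn_genFun` BY NAME (they consume only `Summable δ`).
* §3 ENDs under the station's binder list (`RemainderExplicitHistoryDiagonalSum.sum_disc_diag_le`): **`summable_delta_diag`** and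
  **`cauchySum_diag`** — node U6's Cauchy sum with its source `InjectedRate C c θ` REPLACED by: runs pinned at `g_IR`, summable scale-shift
  profile, summable memory profile, the floor `BetaLowerH b γ β`, `Wγ < b`.  NO NE4 as typed, NO `FadingMemory`, NO rate anywhere.
All letters NOT-IN-PRINT; `BetaFlowAsPrinted S` records a Markov β_n only ⇒ no junction of the as-printed interface changes.
-/

noncomputable section

open Finset Filter Topology

namespace Summit.QuantumFields.BalabanUV.Beta.RemainderExplicitHistoryDiagonalCauchy

open Literature.MathematicalPhysics.QuantumFieldTheory.Balaban1983to89
open Literature.MathematicalPhysics.QuantumFieldTheory.Balaban1983to89.FlowStep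
open Literature.MathematicalPhysics.QuantumFieldTheory.Balaban1983to89.T4CouplingMatching
open Literature.MathematicalPhysics.QuantumFieldTheory.Balaban1983to89.T4CauchySum
  (delta MatchingModConstants genFun genFunLim abs_genFun_succ_sub_le cauchySeq_genFun tendstoUniformlyOn_genFun
    summable_succ_pow_mul_geometric)
open Summit.QuantumFields.BalabanUV.Beta.RemainderExplicitHistoryDiagonalSum (sum_disc_diag_le)
open Summit.QuantumFields.BalabanUV.Beta.RemainderExplicitHistoryDiagonalExistence

variable {β : HBeta} {g : ℕ → ℕ → ℝ} {B : ℕ → ℝ} {γ gIR b E ρ T : ℝ}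

/-! ## §1 Node U6's transported totals summed over the cutoff are the `ρ^m`-weighted diagonal sums -/

/-- **THE RE-INDEXING IDENTITY**: `Σ_{K<L} delta E ρ inj K = E·Σ_{m<L} ρ^m·Σ_{k<L−m} disc (g (k+m)) (g (k+m+1)) k` for
`inj K j = disc (g K) (g (K+1)) j` — on the antidiagonal `j + n = K` the weight `ρ^n` depends on the infrared distance `n` only; collect the
cutoffs `K = k + m < L` along each diagonal `m`. [folklore] -/
theorem sum_delta_eq_sum_diag (E ρ : ℝ) (g : ℕ → ℕ → ℝ) (L : ℕ) :
    ∑ K ∈ range L, delta E ρ (fun K j => disc (g K) (g (K + 1)) j) K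
      = E * ∑ m ∈ range L, ρ ^ m * ∑ k ∈ range (L - m), disc (g (k + m)) (g (k + m + 1)) k := by
  unfold delta
  rw [← Finset.mul_sum]
  congr 1
  -- antidiagonal → range, then two triangle swaps around the shift `K = k + m`
  have h1 : ∀ K, ∑ p ∈ antidiagonal K, disc (g K) (g (K + 1)) p.1 * ρ ^ p.2
      = ∑ k ∈ range (K + 1), disc (g K) (g (K + 1)) k * ρ ^ (K - k) := fun K =>
    Finset.Nat.sum_antidiagonal_eq_sum_range_succ_mk (fun p => disc (g K) (g (K + 1)) p.1 * ρ ^ p.2) K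
  simp_rw [h1]
  have h2 : ∑ K ∈ range L, ∑ k ∈ range (K + 1), disc (g K) (g (K + 1)) k * ρ ^ (K - k)
      = ∑ k ∈ range L, ∑ K ∈ Ico k L, disc (g K) (g (K + 1)) k * ρ ^ (K - k) := by
    refine Finset.sum_comm' fun K k => ?_
    simp only [Finset.mem_range, Finset.mem_Ico]
    omega
  rw [h2]
  have h3 : ∀ k, ∑ K ∈ Ico k L, disc (g K) (g (K + 1)) k * ρ ^ (K - k)
      = ∑ m ∈ range (L - k), ρ ^ m * disc (g (k + m)) (g (k + m + 1)) k := fun k => by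
    rw [Finset.sum_Ico_eq_sum_range]
    exact Finset.sum_congr rfl fun m _ => by rw [Nat.add_sub_cancel_left, mul_comm]
  simp_rw [h3]
  have h4 : ∑ k ∈ range L, ∑ m ∈ range (L - k), ρ ^ m * disc (g (k + m)) (g (k + m + 1)) k
      = ∑ m ∈ range L, ∑ k ∈ range (L - m), ρ ^ m * disc (g (k + m)) (g (k + m + 1)) k := by
    refine Finset.sum_comm' fun k m => ?_
    simp only [Finset.mem_range]
    omega
  rw [h4]
  exact Finset.sum_congr rfl fun m _ => by rw [Finset.mul_sum]

/-- Hence bounded diagonal sums bound the partial sums of the transported totals: `Σ_{K<L} delta K ≤ E·Σ_{m<L} ρ^m B_m` (`E, ρ ≥ 0`). [folklore] -/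
theorem sum_delta_le_of_diag_le (hE : 0 ≤ E) (hρ0 : 0 ≤ ρ)
    (hB : ∀ m N, ∑ n ∈ range N, disc (g (n + m)) (g (n + m + 1)) n ≤ B m) (L : ℕ) :
    ∑ K ∈ range L, delta E ρ (fun K j => disc (g K) (g (K + 1)) j) K ≤ E * ∑ m ∈ range L, ρ ^ m * B m := by
  rw [sum_delta_eq_sum_diag]
  exact mul_le_mul_of_nonneg_left
    (Finset.sum_le_sum fun m _ => mul_le_mul_of_nonneg_left (hB m (L - m)) (pow_nonneg hρ0 m)) hE

/-- The transported totals are nonnegative (`E, ρ ≥ 0`). [folklore] -/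
theorem delta_nonneg (hE : 0 ≤ E) (hρ0 : 0 ≤ ρ) (g : ℕ → ℕ → ℝ) (K : ℕ) :
    0 ≤ delta E ρ (fun K j => disc (g K) (g (K + 1)) j) K := by
  unfold delta
  exact mul_nonneg hE (Finset.sum_nonneg fun p _ => mul_nonneg (disc_nonneg _ _ _) (pow_nonneg hρ0 _))

/-- **NODE U6's TRANSPORTED TOTAL IS SUMMABLE FROM BOUNDED DIAGONAL SUMS**: if `Σ_{n<N} disc (g (n+m)) (g (n+m+1)) n ≤ B_m` for all `m, N` and
`Σ_{m<L} ρ^m B_m ≤ T` for all `L` (`E, ρ ≥ 0`), then `Summable (delta E ρ (fun K j ↦ disc (g K) (g (K+1)) j))` — node U6's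
`summable_delta` with `InjectedRate` replaced by the diagonal currency. [folklore] -/
theorem summable_delta_of_diag_le (hE : 0 ≤ E) (hρ0 : 0 ≤ ρ)
    (hB : ∀ m N, ∑ n ∈ range N, disc (g (n + m)) (g (n + m + 1)) n ≤ B m) (hT : ∀ L, ∑ m ∈ range L, ρ ^ m * B m ≤ T) :
    Summable (delta E ρ (fun K j => disc (g K) (g (K + 1)) j)) :=
  summable_of_sum_range_le (delta_nonneg hE hρ0 g) fun L =>
    (sum_delta_le_of_diag_le hE hρ0 hB L).trans (mul_le_mul_of_nonneg_left (hT L) hE)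

/-- THE LINEAR GROWTH IS HARMLESS: `Σ_{m<L} ρ^m·(m·C) ≤ C·Σ_n (n+1)ρ^n` for `0 ≤ ρ < 1`, `C ≥ 0` (node U6's `summable_succ_pow_mul_geometric`
BY NAME). [folklore] -/
theorem sum_pow_mul_linear_le {C : ℝ} (hρ0 : 0 ≤ ρ) (hρ1 : ρ < 1) (hC : 0 ≤ C) (L : ℕ) :
    ∑ m ∈ range L, ρ ^ m * ((m : ℝ) * C) ≤ C * ∑' n : ℕ, ((n : ℝ) + 1) ^ 1 * ρ ^ n := by
  have hsum := summable_succ_pow_mul_geometric hρ0 hρ1 1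
  have h1 : ∑ m ∈ range L, ρ ^ m * ((m : ℝ) * C) ≤ ∑ m ∈ range L, C * (((m : ℝ) + 1) ^ 1 * ρ ^ m) := by
    refine Finset.sum_le_sum fun m _ => ?_
    have hρm : 0 ≤ ρ ^ m := pow_nonneg hρ0 m
    have : (m : ℝ) * C ≤ ((m : ℝ) + 1) * C := by nlinarith
    nlinarith [mul_le_mul_of_nonneg_left this hρm]
  refine h1.trans ?_
  rw [← Finset.mul_sum]
  exact mul_le_mul_of_nonneg_left (hsum.sum_le_tsum (range L) fun n _ => by positivity) hC

/-! ## §2 Node U6's Cauchy sum from bounded diagonal sums -/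

/-- **NODE U6'S CAUCHY SUM, ASSEMBLED, FROM BOUNDED DIAGONAL SUMS** — `T4CauchySum.cauchySum` with its source `InjectedRate C c θ inj`
REPLACED by the diagonal currency (`Σ_{n<N} disc ≤ B_m`, `Σ_{m<L} ρ^m B_m ≤ T`): with node U5 as `MatchingModConstants vol l₀ (delta E ρ disc) Z`,
the transported totals are summable, consecutive generating functions differ by `≤ 2·vol·delta K` on `|t| ≤ l₀`, every `K ↦ genFun Z K t`
is Cauchy, and the convergence to `genFunLim Z` is uniform on the closed `l₀`-ball.  A CONDITIONAL kernel theorem on NOT-IN-PRINT shapes,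
exactly as node U6's. [cite: King1986, Thm 3.4 p.656] -/
theorem cauchySum_of_diag_le {vol l₀ : ℝ} {Z : ℕ → ℝ → ℝ} (hE : 0 ≤ E) (hρ0 : 0 ≤ ρ) (hl₀ : 0 ≤ l₀)
    (hB : ∀ m N, ∑ n ∈ range N, disc (g (n + m)) (g (n + m + 1)) n ≤ B m) (hT : ∀ L, ∑ m ∈ range L, ρ ^ m * B m ≤ T)
    (hU5 : MatchingModConstants vol l₀ (delta E ρ (fun K j => disc (g K) (g (K + 1)) j)) Z) :
    Summable (delta E ρ (fun K j => disc (g K) (g (K + 1)) j)) ∧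
    (∀ K : ℕ, ∀ t : ℝ, |t| ≤ l₀ →
      |genFun Z (K + 1) t - genFun Z K t| ≤ 2 * (vol * delta E ρ (fun K j => disc (g K) (g (K + 1)) j) K)) ∧
    (∀ t : ℝ, |t| ≤ l₀ → CauchySeq fun K => genFun Z K t) ∧
    TendstoUniformlyOn (fun K t => genFun Z K t) (genFunLim Z) atTop {t | |t| ≤ l₀} := by
  have hδ := summable_delta_of_diag_le hE hρ0 hB hT
  exact ⟨hδ, fun K t ht => abs_genFun_succ_sub_le hU5 hl₀ K ht, fun t ht => cauchySeq_genFun hU5 hl₀ hδ ht,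
    tendstoUniformlyOn_genFun hU5 hl₀ hδ⟩

/-! ## §3 ENDs: node U6's Cauchy sum from a summable scale shift and a summable memory, no NE4 as typed, no fading memory -/

/-- **ROAD P3 — NODE U6's TRANSPORTED TOTAL IS SUMMABLE WITHOUT NE4 AS TYPED AND WITHOUT FADING MEMORY.**  Under the binder list of
`RemainderExplicitHistoryDiagonalSum.sum_disc_diag_le` — runs of (0.20) in ]0,γ] pinned at `g_IR`, scale-shift profile `Σ_{l<n} σ_l ≤ S`,
moduli `0 ≤ Λ k i ≤ ρ′(k − i)` with `Σ_{a<n} ρ′_a ≤ W`, floor `BetaLowerH b γ β` (`b > 0`), `Wγ < b` — and a transport contraction `0 ≤ ρ < 1`,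
`E ≥ 0`: `Summable (delta E ρ (fun K j ↦ disc (g K) (g (K+1)) j))` (the linear diagonal bound `m·S∕(1 − Wγ∕b)` against `Σ_m m·ρ^m < ∞`).
[cite: Balaban1987RG1, (0.20) p.256 and Thm 2 p.259] -/
theorem summable_delta_diag {S W : ℝ} {σ ρ' : ℕ → ℝ} {Λ : ℕ → ℕ → ℝ} (g : ℕ → ℕ → ℝ) (gIR : ℝ)
    (hγ : 0 < γ) (hb : 0 < b) (hσ0 : ∀ l, 0 ≤ σ l) (hρ'0 : ∀ a, 0 ≤ ρ' a)
    (hσS : ∀ n, ∑ l ∈ range n, σ l ≤ S) (hρ'W : ∀ n, ∑ a ∈ range n, ρ' a ≤ W) (hsmall : W * γ < b)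
    (hrun : ∀ K, RGEqH K β (g K)) (hbox : ∀ K i, i ≤ K → 0 < g K i ∧ g K i ≤ γ) (hpin : ∀ K, g K K = gIR)
    (hS : ∀ k (w : Fin (k + 2) → ℝ), w ∈ Box γ (k + 1) → |β (k + 1) w - β k (Fin.tail w)| ≤ σ k)
    (hL : HistLipschitz Λ γ β) (hΛ0 : ∀ k i, i ≤ k → 0 ≤ Λ k i) (hΛρ : ∀ k i, i ≤ k → Λ k i ≤ ρ' (k - i))
    (hlo : BetaLowerH b γ β) (hE : 0 ≤ E) (hρ0 : 0 ≤ ρ) (hρ1 : ρ < 1) :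
    Summable (delta E ρ (fun K j => disc (g K) (g (K + 1)) j)) := by
  have hB := sum_disc_diag_le g gIR hγ hb hσ0 hρ'0 hσS hρ'W hsmall hrun hbox hpin hS hL hΛ0 hΛρ hlo
  have hS0 : 0 ≤ S := by simpa using hσS 0
  have hq : 0 < 1 - W * γ / b := by
    have : W * γ / b < 1 := by rw [div_lt_one hb]; exact hsmall
    linarith
  have hC : 0 ≤ S / (1 - W * γ / b) := div_nonneg hS0 hq.le
  refine summable_delta_of_diag_le (B := fun m => (m : ℝ) * S / (1 - W * γ / b)) hE hρ0 hB (T := S / (1 - W * γ / b)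
    * ∑' n : ℕ, ((n : ℝ) + 1) ^ 1 * ρ ^ n) fun L => ?_
  have h := sum_pow_mul_linear_le (C := S / (1 - W * γ / b)) hρ0 hρ1 hC L
  refine le_trans (le_of_eq (Finset.sum_congr rfl fun m _ => ?_)) h
  ring

/-- **ROAD P3 — NODE U6's CAUCHY SUM WITHOUT NE4 AS TYPED AND WITHOUT FADING MEMORY (END).**  Under the binders of `summable_delta_diag` and
node U5's `MatchingModConstants vol l₀ (delta E ρ disc) Z` (`l₀ ≥ 0`): node U6's four conclusions — summable transported totals, consecutive
generating functions within `2·vol·delta K` on `|t| ≤ l₀`, `CauchySeq (K ↦ genFun Z K t)`, uniform convergence to `genFunLim Z` on the closed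
`l₀`-ball — i.e. `T4CauchySum.cauchySum` with `InjectedRate C c θ` replaced by a summable scale shift + a summable memory profile + the floor +
`Wγ < b`.  CONDITIONAL on NOT-IN-PRINT shapes, exactly as node U6's; nothing of Bałaban's asserted. [cite: King1986, Thm 3.4 p.656] -/
theorem cauchySum_diag {S W vol l₀ : ℝ} {σ ρ' : ℕ → ℝ} {Λ : ℕ → ℕ → ℝ} {Z : ℕ → ℝ → ℝ} (g : ℕ → ℕ → ℝ) (gIR : ℝ)
    (hγ : 0 < γ) (hb : 0 < b) (hσ0 : ∀ l, 0 ≤ σ l) (hρ'0 : ∀ a, 0 ≤ ρ' a)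
    (hσS : ∀ n, ∑ l ∈ range n, σ l ≤ S) (hρ'W : ∀ n, ∑ a ∈ range n, ρ' a ≤ W) (hsmall : W * γ < b)
    (hrun : ∀ K, RGEqH K β (g K)) (hbox : ∀ K i, i ≤ K → 0 < g K i ∧ g K i ≤ γ) (hpin : ∀ K, g K K = gIR)
    (hS : ∀ k (w : Fin (k + 2) → ℝ), w ∈ Box γ (k + 1) → |β (k + 1) w - β k (Fin.tail w)| ≤ σ k)
    (hL : HistLipschitz Λ γ β) (hΛ0 : ∀ k i, i ≤ k → 0 ≤ Λ k i) (hΛρ : ∀ k i, i ≤ k → Λ k i ≤ ρ' (k - i))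
    (hlo : BetaLowerH b γ β) (hE : 0 ≤ E) (hρ0 : 0 ≤ ρ) (hρ1 : ρ < 1) (hl₀ : 0 ≤ l₀)
    (hU5 : MatchingModConstants vol l₀ (delta E ρ (fun K j => disc (g K) (g (K + 1)) j)) Z) :
    Summable (delta E ρ (fun K j => disc (g K) (g (K + 1)) j)) ∧
    (∀ K : ℕ, ∀ t : ℝ, |t| ≤ l₀ →
      |genFun Z (K + 1) t - genFun Z K t| ≤ 2 * (vol * delta E ρ (fun K j => disc (g K) (g (K + 1)) j) K)) ∧
    (∀ t : ℝ, |t| ≤ l₀ → CauchySeq fun K => genFun Z K t) ∧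
    TendstoUniformlyOn (fun K t => genFun Z K t) (genFunLim Z) atTop {t | |t| ≤ l₀} := by
  have hδ := summable_delta_diag g gIR hγ hb hσ0 hρ'0 hσS hρ'W hsmall hrun hbox hpin hS hL hΛ0 hΛρ hlo hE hρ0 hρ1
  exact ⟨hδ, fun K t ht => abs_genFun_succ_sub_le hU5 hl₀ K ht, fun t ht => cauchySeq_genFun hU5 hl₀ hδ ht,
    tendstoUniformlyOn_genFun hU5 hl₀ hδ⟩

end Summit.QuantumFields.BalabanUV.Beta.RemainderExplicitHistoryDiagonalCauchy

end
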